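import Summits.CriticalPhenomena.PercolationContinuityZ3.Theses.PercNonProliferation
import Summits.CriticalPhenomena.PercolationContinuityZ3.Theorems.PercNonProliferationFreeBoxSparseDenseMarkov
import Literature.Barriers.CriticalPhenomena.KozmaNachmiasLemma11Steps

/-!
# Crux triage r2-k1 — scratch checks (crux stmt-CriticalPhenomena-4445 `FreeBoxSparse`)

§1  Card `uniqueness-zone-segregation`: its typed residual `NoSegregatedCoexistence` (copied verbatim
    from `Cruxes/FreeBoxSparse/SketchIdeator4.lean`) is IMPLIED BY THE CRUX in a few lines of Markov
    (`real_exists_dense_le_pairAverage_div`, landed p88271 for the dead line) — the same two-line converse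
    that made `stub_corridor ⟺ crux`; the other direction is the card's own composition through the landed
    `stub_ceiling`/`stub_boost`.  So the residual is crux-equivalent modulo landed stubs and the segregation
    lemma is idle in the composition.
§2  Card `axis-fold-linear-depth-bgn`: the `ρ = 0` endpoint of its residual family is the landed item
    stmt-0914 `PercLowPointHalfSpace.HalfSpaceAxisDecay` (PROVED, `halfSpaceAxisDecay_proof`):
    `axisConn 0 m ≤ P(0 ↔_ℍ (2m) e₀)` by box ⊆ shifted half-space + `real_openConnIn_image_iso`, hence
    `HalfSpaceAxisDecay → AxisDecay 0` (`axisDecay_zero_of_halfSpaceAxisDecay`, sorry-free).  With the card's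
    ChainLemma + `axisConn_mono`, `AxisDecay ρ` is moreover ρ-independent on `(0,∞)` (prose, TRIAGE-r2-1.md).
-/

noncomputable section

open MeasureTheory Filter Topology
open Literature.Probability.Percolation Literature.Probability.LatticeModels
open scoped Classical

namespace TriageR2K1

abbrev V3 : Type := Site 3
abbrev μ (p : unitInterval) : Measure (BondConfig V3) := bondPercolation (zdGraph 3) p

/-! ## §1 verbatim vocabulary of SketchIdeator4 -/

def pieceCard (Λ : Finset V3) (ω : BondConfig V3) (x : V3) : ℕ :=
  (Λ.filter fun v => ω ∈ openConnIn (↑Λ : Set V3) x v).card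

def IsDenseIn (a : ℝ) (Λ : Finset V3) (ω : BondConfig V3) (x : V3) : Prop :=
  a * (Λ.card : ℝ) ≤ (pieceCard Λ ω x : ℝ)

/-- Verbatim copy of `SketchIdeator4.NoSegregatedCoexistence` (the card's typed residual). -/
def NoSegregatedCoexistence : Prop :=
  ∀ a ε : ℝ, 0 < a → 0 < ε → ∃ N : ℕ, ∀ n : ℕ, N ≤ n →
    (1 - ε ≤ (μ (criticalProbI 3)).real {ω | ∃ x ∈ box 3 n, IsDenseIn a (box 3 n) ω x}) →
      (μ (criticalProbI 3)).real {ω | ∃ x ∈ box 3 n, ∃ x' ∈ box 3 n,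
        ω ∉ openConnIn (↑(box 3 (2 * n)) : Set V3) x x' ∧
        IsDenseIn a (box 3 n) ω x ∧ IsDenseIn a (box 3 n) ω x'} < ε

/-- **The card's residual is implied by the crux** (two lines of Markov, exactly as for the dead line's
`stub_corridor`): `P(∃ a-dense piece of Λ_n) ≤ FA₂(p_c,n)/a² → 0`, so for `ε < 1` the giant-scale
hypothesis fails eventually and for `ε ≥ 1` the conclusion event (⊆ {∃ dense piece}) has probability
`< 1 ≤ ε` eventually. -/
theorem noSegregatedCoexistence_of_freeBoxSparse
    (hS : Summit.CriticalPhenomena.PercolationContinuityZ3.Theses.PercNonProliferation.FreeBoxSparse) :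
    NoSegregatedCoexistence := by
  intro a ε ha hε
  set q : ℕ → ℝ := fun n => (μ (criticalProbI 3)).real {ω | ∃ x ∈ box 3 n, IsDenseIn a (box 3 n) ω x}
    with hq
  have hup : ∀ n, q n ≤ ((∑ x ∈ box 3 n, ∑ y ∈ box 3 n,
      (bondPercolation (zdGraph 3) (criticalProbI 3)).real (openConnIn (↑(box 3 n) : Set (Site 3)) x y)) /
        (((box 3 n).card : ℝ)) ^ 2) / a ^ 2 := fun n =>
    Summit.CriticalPhenomena.PercolationContinuityZ3.Theorems.FreeBoxSparse.real_exists_dense_le_pairAverage_div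
      (criticalProbI 3) (box_nonempty 3 n) ha
  have hlim : Tendsto (fun n : ℕ => ((∑ x ∈ box 3 n, ∑ y ∈ box 3 n,
      (bondPercolation (zdGraph 3) (criticalProbI 3)).real (openConnIn (↑(box 3 n) : Set (Site 3)) x y)) /
        (((box 3 n).card : ℝ)) ^ 2) / a ^ 2) atTop (𝓝 0) := by
    simpa using hS.div_const (a ^ 2)
  have hq0 : Tendsto q atTop (𝓝 0) := squeeze_zero (fun n => measureReal_nonneg) hup hlim
  have hsub : ∀ n, {ω : BondConfig V3 | ∃ x ∈ box 3 n, ∃ x' ∈ box 3 n,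
        ω ∉ openConnIn (↑(box 3 (2 * n)) : Set V3) x x' ∧
        IsDenseIn a (box 3 n) ω x ∧ IsDenseIn a (box 3 n) ω x'} ⊆
      {ω | ∃ x ∈ box 3 n, IsDenseIn a (box 3 n) ω x} := by
    intro n ω hω
    obtain ⟨x, hx, _, _, _, hdx, _⟩ := hω
    exact ⟨x, hx, hdx⟩
  by_cases hε1 : ε < 1
  · obtain ⟨N₁, hN₁⟩ := eventually_atTop.1 ((tendsto_order.1 hq0).2 (1 - ε) (by linarith))
    refine ⟨N₁, fun n hn hhyp => ?_⟩
    exact absurd hhyp (not_le.2 (hN₁ n hn))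
  · push Not at hε1
    obtain ⟨N₁, hN₁⟩ := eventually_atTop.1 ((tendsto_order.1 hq0).2 1 one_pos)
    refine ⟨N₁, fun n hn _ => ?_⟩
    calc (μ (criticalProbI 3)).real {ω | ∃ x ∈ box 3 n, ∃ x' ∈ box 3 n,
            ω ∉ openConnIn (↑(box 3 (2 * n)) : Set V3) x x' ∧
            IsDenseIn a (box 3 n) ω x ∧ IsDenseIn a (box 3 n) ω x'}
        ≤ q n := measureReal_mono (hsub n)
      _ < 1 := hN₁ n hn
      _ ≤ ε := hε1


/-! ## §2 Card `axis-fold-linear-depth-bgn`: the `ρ = 0` endpoint is the landed item stmt-0914 -/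

namespace AxisFold
/-! verbatim vocabulary of `SketchIdeator5r2.lean` -/
def axisPt (t : ℤ) : Site 3 := fun i => if i = 0 then t else 0
def boxRadius (ρ : ℝ) (m : ℕ) : ℕ := ⌈(1 + ρ) * (m : ℝ)⌉₊
def axisConn (ρ : ℝ) (m : ℕ) : ℝ :=
  (bondPercolation (zdGraph 3) (criticalProbI 3)).real
    (openConnIn (↑(box 3 (boxRadius ρ m)) : Set (Site 3)) (axisPt (-(m : ℤ))) (axisPt m))
def AxisDecay (ρ : ℝ) : Prop := Tendsto (axisConn ρ) atTop (𝓝 0)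
end AxisFold

theorem boxRadius_zero (m : ℕ) : AxisFold.boxRadius 0 m = m := by
  simp [AxisFold.boxRadius]

/-- `Λ_m ⊆ (-m e₀) + ℍ`, `ℍ = {x | 0 ≤ x 0}`. [folklore] -/
theorem box_subset_shift_halfSpace (m : ℕ) :
    (↑(box 3 m) : Set (Site 3)) ⊆
      (zdShiftIso (AxisFold.axisPt (-(m : ℤ)))) '' {x : Site 3 | 0 ≤ x 0} := by
  intro w hw
  refine ⟨w - AxisFold.axisPt (-(m : ℤ)), ?_, by simp⟩
  have h0 := ((mem_box.1 (Finset.mem_coe.1 hw)) 0).1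
  show 0 ≤ (w - AxisFold.axisPt (-(m : ℤ))) 0
  have : (w - AxisFold.axisPt (-(m : ℤ))) 0 = w 0 + m := by simp [AxisFold.axisPt]
  rw [this]; linarith

/-- The two axis points are the translates of `0` and `2m e₀` by `-m e₀`. [folklore] -/
theorem axisPt_neg_eq (m : ℕ) : AxisFold.axisPt (-(m : ℤ)) = (0 : Site 3) + AxisFold.axisPt (-(m : ℤ)) := by
  simp

theorem axisPt_pos_eq (m : ℕ) :
    AxisFold.axisPt (m : ℤ) = (Pi.single 0 ((2 * m : ℕ) : ℤ) : Site 3) + AxisFold.axisPt (-(m : ℤ)) := by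
  funext i
  by_cases hi : i = 0
  · subst hi; simp [AxisFold.axisPt]; ring
  · simp [AxisFold.axisPt, hi]

/-- **`axisConn 0 m ≤ P_{p_c}(0 ↔_ℍ 2m e₀)`**: box ⊆ shifted half-space, then translate by `m e₀`
(`real_openConnIn_image_iso`). [folklore] -/
theorem axisConn_zero_le (m : ℕ) :
    AxisFold.axisConn 0 m ≤ (bondPercolation (zdGraph 3) (criticalProbI 3)).real
      (openConnIn {x : Site 3 | 0 ≤ x 0} 0 (Pi.single 0 ((2 * m : ℕ) : ℤ) : Site 3)) := by
  rw [← Literature.Barriers.CriticalPhenomena.real_openConnIn_image_iso (criticalProbI 3)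
    (zdShiftIso (AxisFold.axisPt (-(m : ℤ)))) {x : Site 3 | 0 ≤ x 0} 0 (Pi.single 0 ((2 * m : ℕ) : ℤ))]
  unfold AxisFold.axisConn
  refine measureReal_mono ?_ (measure_ne_top _ _)
  rw [boxRadius_zero, zdShiftIso_apply, zdShiftIso_apply, ← axisPt_neg_eq, ← axisPt_pos_eq]
  exact openConnIn_mono (box_subset_shift_halfSpace m) _ _

/-- **The `ρ = 0` endpoint of the card's residual family is the landed item stmt-0914**: the hypothesis
`h` is the body of `Summit.CriticalPhenomena.PercolationContinuityZ3.Theses.PercLowPointHalfSpace.HalfSpaceAxisDecay`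
VERBATIM (proved in tree by `Theorems.halfSpaceAxisDecay_proof`; stated inline here only to keep this scratch
file independent of a second route file); conclusion along `n = 2m`. -/
theorem axisDecay_zero_of_halfSpaceAxisDecay
    (h : Filter.Tendsto (fun n : ℕ => (Literature.Probability.Percolation.bondPercolation
      (Literature.Probability.LatticeModels.zdGraph 3) (Literature.Probability.Percolation.criticalProbI 3)).real
      (Literature.Probability.Percolation.openConnIn {x : Literature.Probability.LatticeModels.Site 3 | 0 ≤ x 0} 0
        (Pi.single 0 (n : ℤ) : Literature.Probability.LatticeModels.Site 3))) Filter.atTop (nhds 0)) :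
    AxisFold.AxisDecay 0 := by
  have h2 : Tendsto (fun m : ℕ => (bondPercolation (zdGraph 3) (criticalProbI 3)).real
      (openConnIn {x : Site 3 | 0 ≤ x 0} 0 (Pi.single 0 ((2 * m : ℕ) : ℤ) : Site 3))) atTop (𝓝 0) :=
    h.comp (tendsto_id.const_mul_atTop' (by norm_num : 0 < 2))
  exact squeeze_zero (fun m => measureReal_nonneg) axisConn_zero_le h2

end TriageR2K1

end
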